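import Literature.MathematicalPhysics.StatisticalMechanics.CrystallizationSymmetries
import Literature.MathematicalPhysics.StatisticalMechanics.MuGroundStateConfiguration
import HarnessLib

/-!
# Local limits of translated ground states (the class `𝔏`)

Topic: `Literature/MathematicalPhysics/StatisticalMechanics`. Definition request
`defn-IsLocalLimitOfGroundStates` (route `AtomisticToContinuum/Crystallization/GscTwinLoopSurgery`,
whose items `LocalLimitStable`, `LayeredWindows`, `TwinLoopLemma`, `HcpPerfectWindows` inline the
notion as the hypothesis "`X ∈ 𝔏`", the class of local limits of translated Lennard-Jones ground
states).

## Content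

* `IsLocalLimitOfGroundStates V d X` — **`X ⊆ ℝᵈ` is a local limit of translated ground states
  of the pair potential `V`**: there are ground states `x^N` of `V` (one for every particle
  number `N`: `IsGroundState V (x N)`, `Crystallization.lean`), a subsequence `σ`
  (`StrictMono σ`) and translations `τ_j ∈ ℝᵈ` such that for every radius `R` and every
  tolerance `ε > 0`, eventually in `j`, the translated configuration `x^(σ j) + τ_j` and `X` are
  two-way `ε`-matched on the closed ball `‖·‖ ≤ R`: every point of `X` in the ball has a
  particle within `ε`, and every particle in the ball has a point of `X` within `ε`.
  This is convergence of the point sets `{xᵢ^(σ j) + τ_j}` to `X` in the local rubber (local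
  Hausdorff) topology of point sets (Baake–Lenz 2004; Baake–Grimm 2013, Remark 5.6: "two Delone
  sets `Λ` and `Λ'` are `ε`-close when they agree on a central ball of radius `1/ε`, possibly
  after moving the individual points of one set by at most a distance `ε`"), applied to the
  translated subsequences `x^(N_j) + τ_j` of ground states of Blanc–Lewin 2015, §2.1 (16), where
  the limit is taken for the empirical measures `μ_{N_j}(· - τ_j)` in the local (vague)
  topology. For configurations with a uniform minimal distance the limit measure is the
  multiplicity-free point measure `∑_{p ∈ X} δ_p` (Blanc–Lewin 2015, §2.2) and two-way matching
  on balls implies the vague convergence (`PeriodicConfiguration.tendsto_sum_of_eventually_near`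
  in `CrystallizationLocalLimit.lean`, for periodic `X`).
* API: `isLocalLimitOfGroundStates_iff` (definitional unfolding: the body is LITERALLY the
  route's inline clause with `lennardJones ↦ V`, `3 ↦ d`, so the items restate by `Iff.rfl`);
  `ballMatch_zero_range_iff`, `isLocalLimitOfGroundStates_iff_ballMatch` (the matching clause is
  `BallMatch ε R 0 (range (x^(σ j) + τ_j)) X` of `MuGroundStateConfiguration.lean`);
  `IsLocalLimitOfGroundStates.image_add_const`, `.image_linearIsometry` (`𝔏` is invariant under
  translations and linear isometries of `ℝᵈ` — Blanc–Lewin 2015, §1.1: isometric images of ground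
  states are ground states, `isGroundState_comp_isometry_iff`); `le_dist_of_eventually_matched`,
  `IsLocalLimitOfGroundStates.le_dist`, `.uniformlyDiscrete` (a uniform minimal distance of the
  ground states passes to every local limit, e.g. `LennardJonesMinimalDistance` for Lennard-Jones
  in `ℝ³`: `.uniformlyDiscrete_lennardJones`); `isLocalLimitOfGroundStates_empty` (if ground
  states exist for every `N` and `d ≥ 1`, the EMPTY set is a local limit — translate the clusters
  to infinity; this is why the route's items add an `r₀`-relative-density hypothesis on `X`);
  `IsLocalLimitOfGroundStates.of_eventually_ballMatch` (**`𝔏` is closed under local limits**: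
  if `X_k ∈ 𝔏` and eventually `BallMatch ε R 0 (X_k) X` for every `R`, `ε > 0`, then `X ∈ 𝔏`,
  by the diagonal argument) and `.of_forall_ballMatch` (same closure ⟹ same membership).

## Design choices

* A predicate with `V`, `d`, `X` explicit (the requested signature
  `IsLocalLimitOfGroundStates V d X`); nothing beyond the route's clause is built in: no
  closedness, discreteness, density or non-emptiness of `X` (if `X ∈ 𝔏` then every `Y` with
  the same closure is in `𝔏`), the matching witnesses may lie outside the ball (as in
  `BallMatch`), and `R` ranges over all reals (for `R < 0` both clauses are vacuous).
* The witness family carries one ground state for EVERY `N` although only the subsequence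
  `σ` is matched — the route's convention (for Lennard-Jones in `ℝ³` any partial family is
  padded by `LennardJonesGroundStatesExist_holds`).
* The geometric lemma `le_dist_of_eventually_matched` is stated for an arbitrary sequence of
  finite configurations `y j : Fin (n j) → ℝᵈ` and the bare matching clause (the shape of the
  hypothesis of `PeriodicConfiguration.tendsto_sum_of_eventually_near`), then specialised.
* Not here: sequential compactness of `𝔏` modulo translations (every sequence in `𝔏` with a
  common minimal distance has a locally convergent subsequence — a Hausdorff-metric compactness
  on balls plus the diagonal lemma above), existence of NON-EMPTY local limits, and the
  stability of local limits (`LocalLimitStable`, a route item): `𝔏` is not asserted here to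
  consist of ground state configurations in the sense of Radin/Sütő.

## References

* X. Blanc, M. Lewin, *The crystallization conjecture: a review*, EMS Surv. Math. Sci. 2 (2015),
  255–306, arXiv:1504.01153, §1.1 (p. 3), §2.1 (15)–(17), §2.2.
* M. Baake, U. Grimm, *Aperiodic Order*, vol. 1, Cambridge Univ. Press 2013, §5.4 (local
  topology, p. 152) and Remark 5.6 (local rubber topology and Hausdorff metric, p. 155).
* M. Baake, D. Lenz, *Dynamical systems on translation bounded measures*, Ergodic Theory Dynam.
  Systems 24 (2004), 1867–1893 (the local rubber topology; cited through Baake–Grimm 2013).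
-/

noncomputable section

open scoped BigOperators Topology
open Filter Set Metric

namespace Literature.MathematicalPhysics.StatisticalMechanics

/-! ## The definition -/

/-- **`X ⊆ ℝᵈ` is a local limit of translated ground states of `V`** (`X ∈ 𝔏`): there are
ground states `x^N` of the pair potential `V` (one for every `N`), a strictly increasing
`σ : ℕ → ℕ` and translations `τ_j` such that for every radius `R` and every `ε > 0`, eventually
in `j`, every point `p ∈ X` with `‖p‖ ≤ R` has a particle `xᵢ^(σ j) + τ_j` within `ε` and every
particle `xᵢ^(σ j) + τ_j` of norm `≤ R` has a point of `X` within `ε` — the translated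
subsequence of ground states (Blanc–Lewin 2015, §2.1 (16)) converges to `X` as a point set,
locally and up to `ε`-displacements (the local rubber topology, Baake–Grimm 2013, Remark 5.6).
[folklore] -/
def IsLocalLimitOfGroundStates (V : ℝ → ℝ) (d : ℕ) (X : Set (EuclideanSpace ℝ (Fin d))) : Prop :=
  ∃ (x : (N : ℕ) → (Fin N → EuclideanSpace ℝ (Fin d))) (σ : ℕ → ℕ)
    (τ : ℕ → EuclideanSpace ℝ (Fin d)),
    (∀ N, IsGroundState V (x N)) ∧ StrictMono σ ∧ ∀ R ε : ℝ, 0 < ε → ∀ᶠ j : ℕ in Filter.atTop,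
      (∀ p ∈ X, ‖p‖ ≤ R → ∃ i : Fin (σ j), dist (x (σ j) i + τ j) p ≤ ε) ∧
        (∀ i : Fin (σ j), ‖x (σ j) i + τ j‖ ≤ R → ∃ p ∈ X, dist (x (σ j) i + τ j) p ≤ ε)

variable {V : ℝ → ℝ} {d : ℕ} {X : Set (EuclideanSpace ℝ (Fin d))}

/-- Unfolding of `IsLocalLimitOfGroundStates` (by `Iff.rfl`; the right-hand side is the clause
inlined in the route items, with `V`, `d` for `lennardJones`, `3`). [folklore] -/
theorem isLocalLimitOfGroundStates_iff :
    IsLocalLimitOfGroundStates V d X ↔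
      ∃ (x : (N : ℕ) → (Fin N → EuclideanSpace ℝ (Fin d))) (σ : ℕ → ℕ)
        (τ : ℕ → EuclideanSpace ℝ (Fin d)),
        (∀ N, IsGroundState V (x N)) ∧ StrictMono σ ∧ ∀ R ε : ℝ, 0 < ε →
          ∀ᶠ j : ℕ in Filter.atTop,
            (∀ p ∈ X, ‖p‖ ≤ R → ∃ i : Fin (σ j), dist (x (σ j) i + τ j) p ≤ ε) ∧
              (∀ i : Fin (σ j), ‖x (σ j) i + τ j‖ ≤ R → ∃ p ∈ X, dist (x (σ j) i + τ j) p ≤ ε) :=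
  Iff.rfl

/-! ## The matching clause as `BallMatch` -/

/-- The two-way matching of a finite configuration `y` (as the point set `range y`) and `X` on
the ball `‖·‖ ≤ R` about the origin, `BallMatch ε R 0 (range y) X`, is the pair of clauses used
in `IsLocalLimitOfGroundStates`. [folklore] -/
theorem ballMatch_zero_range_iff {n : ℕ} (y : Fin n → EuclideanSpace ℝ (Fin d)) (ε R : ℝ) :
    BallMatch ε R 0 (Set.range y) X ↔
      (∀ p ∈ X, ‖p‖ ≤ R → ∃ i, dist (y i) p ≤ ε) ∧
        (∀ i, ‖y i‖ ≤ R → ∃ p ∈ X, dist (y i) p ≤ ε) := by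
  simp only [BallMatch, Set.forall_mem_range, Set.exists_range_iff, dist_zero_right]

/-- `X ∈ 𝔏` iff some translated subsequence of ground states is, for every `R` and `ε > 0`,
eventually `BallMatch`ed with `X` at tolerance `ε` on the ball of radius `R` about `0`.
[folklore] -/
theorem isLocalLimitOfGroundStates_iff_ballMatch :
    IsLocalLimitOfGroundStates V d X ↔
      ∃ (x : (N : ℕ) → (Fin N → EuclideanSpace ℝ (Fin d))) (σ : ℕ → ℕ)
        (τ : ℕ → EuclideanSpace ℝ (Fin d)),
        (∀ N, IsGroundState V (x N)) ∧ StrictMono σ ∧ ∀ R ε : ℝ, 0 < ε →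
          ∀ᶠ j : ℕ in Filter.atTop, BallMatch ε R 0 (Set.range fun i => x (σ j) i + τ j) X := by
  simp only [IsLocalLimitOfGroundStates, ballMatch_zero_range_iff]

/-! ## Invariance under translations and linear isometries -/

/-- `𝔏` is translation invariant: if `X` is a local limit of translated ground states, so is
`X + v` (shift the translations `τ_j` by `v` and enlarge the radius by `‖v‖`). [folklore] -/
theorem IsLocalLimitOfGroundStates.image_add_const (h : IsLocalLimitOfGroundStates V d X)
    (v : EuclideanSpace ℝ (Fin d)) :
    IsLocalLimitOfGroundStates V d ((fun p => p + v) '' X) := by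
  obtain ⟨x, σ, τ, hx, hσ, hlim⟩ := h
  refine ⟨x, σ, fun j => τ j + v, hx, hσ, fun R ε hε => ?_⟩
  filter_upwards [hlim (R + ‖v‖) ε hε] with j hj
  obtain ⟨hA, hB⟩ := hj
  refine ⟨?_, fun i hi => ?_⟩
  · rintro _ ⟨p, hp, rfl⟩ hpR
    have hpR' : ‖p‖ ≤ R + ‖v‖ := by
      have h1 : ‖p‖ ≤ ‖p + v‖ + ‖v‖ :=
        calc ‖p‖ = ‖p + v - v‖ := by rw [add_sub_cancel_right]
          _ ≤ ‖p + v‖ + ‖v‖ := norm_sub_le _ _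
      linarith
    obtain ⟨i, hi⟩ := hA p hp hpR'
    exact ⟨i, by rwa [← add_assoc, dist_add_right]⟩
  · have hiR : ‖x (σ j) i + τ j‖ ≤ R + ‖v‖ := by
      have h1 : ‖x (σ j) i + τ j‖ ≤ ‖x (σ j) i + τ j + v‖ + ‖v‖ :=
        calc ‖x (σ j) i + τ j‖ = ‖x (σ j) i + τ j + v - v‖ := by rw [add_sub_cancel_right]
          _ ≤ ‖x (σ j) i + τ j + v‖ + ‖v‖ := norm_sub_le _ _
      rw [← add_assoc] at hi
      linarith
    obtain ⟨p, hp, hip⟩ := hB i hiR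
    exact ⟨p + v, Set.mem_image_of_mem _ hp, by rwa [← add_assoc, dist_add_right]⟩

/-- `𝔏` is invariant under linear isometries `A` of `ℝᵈ` (rotations, reflexions): the image
`A '' X` of a local limit is the local limit of the isometric images of the same ground states
(which are ground states, Blanc–Lewin 2015, §1.1: `isGroundState_comp_isometry_iff`) translated
by `A τ_j`. [folklore] -/
theorem IsLocalLimitOfGroundStates.image_linearIsometry (h : IsLocalLimitOfGroundStates V d X)
    (A : EuclideanSpace ℝ (Fin d) →ₗᵢ[ℝ] EuclideanSpace ℝ (Fin d)) :
    IsLocalLimitOfGroundStates V d (A '' X) := by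
  obtain ⟨x, σ, τ, hx, hσ, hlim⟩ := h
  refine ⟨fun N i => A (x N i), σ, fun j => A (τ j),
    fun N => (isGroundState_comp_isometry_iff V A.isometry).2 (hx N), hσ, fun R ε hε => ?_⟩
  filter_upwards [hlim R ε hε] with j hj
  obtain ⟨hA, hB⟩ := hj
  refine ⟨?_, fun i hi => ?_⟩
  · rintro _ ⟨p, hp, rfl⟩ hpR
    rw [A.norm_map] at hpR
    obtain ⟨i, hi⟩ := hA p hp hpR
    exact ⟨i, by rwa [← A.map_add, A.dist_map]⟩
  · rw [← A.map_add, A.norm_map] at hi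
    obtain ⟨p, hp, hip⟩ := hB i hi
    exact ⟨A p, Set.mem_image_of_mem _ hp, by rwa [← A.map_add, A.dist_map]⟩

/-! ## Uniform separation passes to local limits -/

/-- If finite configurations `y j` with a uniform minimal distance `δ` are, for every `R` and
`ε > 0`, eventually two-way `ε`-matched with `X` on the ball `‖·‖ ≤ R`, then distinct points of
`X` are at distance `≥ δ` (match `p ≠ q` at a scale `ε` below `dist p q / 4`: the two particles
are distinct, hence `δ`-separated, and within `2ε` of `p`, `q`). [folklore] -/
theorem le_dist_of_eventually_matched {n : ℕ → ℕ}
    {y : (j : ℕ) → Fin (n j) → EuclideanSpace ℝ (Fin d)} {δ : ℝ}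
    (hsep : ∀ j i i', i ≠ i' → δ ≤ dist (y j i) (y j i'))
    (h : ∀ R ε : ℝ, 0 < ε → ∀ᶠ j : ℕ in Filter.atTop,
      (∀ p ∈ X, ‖p‖ ≤ R → ∃ i, dist (y j i) p ≤ ε) ∧
        (∀ i, ‖y j i‖ ≤ R → ∃ p ∈ X, dist (y j i) p ≤ ε))
    {p q : EuclideanSpace ℝ (Fin d)} (hp : p ∈ X) (hq : q ∈ X) (hpq : p ≠ q) : δ ≤ dist p q := by
  have hpq0 : 0 < dist p q := dist_pos.2 hpq
  refine le_of_forall_pos_lt_add fun η hη => ?_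
  set ε : ℝ := min (η / 4) (dist p q / 4) with hε
  have hε0 : 0 < ε := lt_min (by linarith) (by linarith)
  have hεη : ε ≤ η / 4 := min_le_left _ _
  have hεpq : ε ≤ dist p q / 4 := min_le_right _ _
  obtain ⟨j, hA, -⟩ := (h (max ‖p‖ ‖q‖) ε hε0).exists
  obtain ⟨i, hi⟩ := hA p hp (le_max_left _ _)
  obtain ⟨i', hi'⟩ := hA q hq (le_max_right _ _)
  by_cases hii' : i = i'
  · subst hii'
    have : dist p q ≤ 2 * ε :=
      calc dist p q ≤ dist (y j i) p + dist (y j i) q := dist_triangle_left _ _ _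
        _ ≤ ε + ε := add_le_add hi hi'
        _ = 2 * ε := by ring
    linarith
  · have h1 := hsep j i i' hii'
    have hi'' : dist q (y j i') ≤ ε := by rwa [dist_comm] at hi'
    have : dist (y j i) (y j i') ≤ dist p q + 2 * ε :=
      calc dist (y j i) (y j i') ≤ dist (y j i) p + dist p (y j i') := dist_triangle _ _ _
        _ ≤ dist (y j i) p + (dist p q + dist q (y j i')) :=
          add_le_add le_rfl (dist_triangle _ _ _)
        _ ≤ ε + (dist p q + ε) := add_le_add hi (add_le_add le_rfl hi'')
        _ = dist p q + 2 * ε := by ring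
    linarith

/-- A uniform minimal distance `δ` of the ground states of `V` (all `N`) passes to every local
limit of translated ground states: distinct points of `X ∈ 𝔏` are at distance `≥ δ`
(Blanc–Lewin 2015, §2.2: local limits of uniformly separated minimisers are multiplicity-free
and uniformly discrete). [folklore] -/
theorem IsLocalLimitOfGroundStates.le_dist (h : IsLocalLimitOfGroundStates V d X) {δ : ℝ}
    (hsep : ∀ (N : ℕ) (x : Fin N → EuclideanSpace ℝ (Fin d)), IsGroundState V x →
      ∀ i j, i ≠ j → δ ≤ dist (x i) (x j))
    {p q : EuclideanSpace ℝ (Fin d)} (hp : p ∈ X) (hq : q ∈ X) (hpq : p ≠ q) : δ ≤ dist p q := by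
  obtain ⟨x, σ, τ, hx, -, hlim⟩ := h
  refine le_dist_of_eventually_matched (y := fun j i => x (σ j) i + τ j) (fun j i i' hii' => ?_)
    hlim hp hq hpq
  rw [dist_add_right]
  exact hsep _ _ (hx _) i i' hii'

/-- Under a uniform minimal distance `δ > 0` of the ground states, every `X ∈ 𝔏` is uniformly
discrete (`UniformlyDiscrete`, `MuGroundStateConfiguration.lean`). [folklore] -/
theorem IsLocalLimitOfGroundStates.uniformlyDiscrete (h : IsLocalLimitOfGroundStates V d X)
    {δ : ℝ} (hδ : 0 < δ)
    (hsep : ∀ (N : ℕ) (x : Fin N → EuclideanSpace ℝ (Fin d)), IsGroundState V x →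
      ∀ i j, i ≠ j → δ ≤ dist (x i) (x j)) :
    UniformlyDiscrete X :=
  ⟨δ, hδ, fun _ hp _ hq hpq => h.le_dist hsep hp hq hpq⟩

/-- Lennard-Jones in `ℝ³`: under the minimal-distance fact `LennardJonesMinimalDistance`
(Xue 1997; Blanc–Lewin 2015, §2.2) every local limit of translated Lennard-Jones ground states
is uniformly discrete. [folklore] -/
theorem IsLocalLimitOfGroundStates.uniformlyDiscrete_lennardJones
    {X : Set (EuclideanSpace ℝ (Fin 3))} (h : IsLocalLimitOfGroundStates lennardJones 3 X)
    (hmin : LennardJonesMinimalDistance) : UniformlyDiscrete X := by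
  obtain ⟨δ, hδ, hsep⟩ := hmin
  exact h.uniformlyDiscrete hδ hsep

/-! ## The empty local limit -/

/-- **The vacuum is a local limit.** If `d ≥ 1` and `V` has ground states for every `N`, then
`∅ ∈ 𝔏`: translate the `N`-th cluster by `(∑ᵢ ‖xᵢ^N‖ + N + 1) e₁`, so that no particle of the
`j`-th translated cluster has norm `≤ j`. (Hence statements about `X ∈ 𝔏` that need particles
assume relative density of `X`.) [folklore] -/
theorem isLocalLimitOfGroundStates_empty (hd : 0 < d)
    (hex : ∀ N : ℕ, ∃ x : Fin N → EuclideanSpace ℝ (Fin d), IsGroundState V x) :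
    IsLocalLimitOfGroundStates V d ∅ := by
  choose x hx using hex
  set e : EuclideanSpace ℝ (Fin d) := EuclideanSpace.single ⟨0, hd⟩ (1 : ℝ) with he_def
  have he : ‖e‖ = 1 := by simp [he_def]
  set M : ℕ → ℝ := fun j => ∑ i, ‖x j i‖ with hM_def
  have hM0 : ∀ j, 0 ≤ M j := fun j => Finset.sum_nonneg fun i _ => norm_nonneg _
  have hMi : ∀ j i, ‖x j i‖ ≤ M j := fun j i =>
    Finset.single_le_sum (f := fun i => ‖x j i‖) (fun i _ => norm_nonneg _) (Finset.mem_univ i)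
  refine ⟨x, fun j => j, fun j => (M j + j + 1) • e, hx, strictMono_id, fun R ε _ => ?_⟩
  filter_upwards [Filter.eventually_ge_atTop ⌈R⌉₊] with j hj
  have hjR : R ≤ (j : ℝ) := Nat.ceil_le.1 hj
  refine ⟨fun p hp => absurd hp (Set.notMem_empty p), fun i hi => ?_⟩
  exfalso
  have hτ : ‖(M j + j + 1) • e‖ = M j + j + 1 := by
    rw [norm_smul, he, mul_one, Real.norm_of_nonneg (by linarith [hM0 j])]
  have h1 : ‖(M j + j + 1) • e‖ ≤ ‖x j i + (M j + j + 1) • e‖ + ‖x j i‖ :=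
    calc ‖(M j + j + 1) • e‖ = ‖x j i + (M j + j + 1) • e - x j i‖ := by rw [add_sub_cancel_left]
      _ ≤ ‖x j i + (M j + j + 1) • e‖ + ‖x j i‖ := norm_sub_le _ _
  rw [hτ] at h1
  linarith [hMi j i]

/-! ## Closedness of `𝔏` under local limits (diagonal argument) -/

/-- `‖a‖ ≤ ‖b‖ + dist a b`. [folklore] -/
private theorem norm_le_norm_add_dist (a b : EuclideanSpace ℝ (Fin d)) :
    ‖a‖ ≤ ‖b‖ + dist a b := by
  rw [dist_eq_norm]
  linarith [norm_sub_norm_le a b]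

/-- Diagonal indices for `IsLocalLimitOfGroundStates.of_eventually_ballMatch`: `j_0 = J 0`,
`j_{k+1} = max (J (k+1)) (σ_k (j_k) + 1)`, so that `j_k ≥ J k` and `k ↦ σ_k (j_k)` is strictly
increasing. [folklore] -/
private def diagIdx (J : ℕ → ℕ) (σ : ℕ → ℕ → ℕ) : ℕ → ℕ
  | 0 => J 0
  | k + 1 => max (J (k + 1)) (σ k (diagIdx J σ k) + 1)

/-- **`𝔏` is closed under local limits.** If `X_k ∈ 𝔏` for every `k` and `X_k → X` locally —
for every `R` and `ε > 0`, eventually in `k`, `X_k` and `X` are two-way `ε`-matched on the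
ball `‖·‖ ≤ R` (`BallMatch ε R 0 (X_k) X`) — then `X ∈ 𝔏`. Diagonal argument: match `X_k` at
scale `(R, ε) = (k, 1/(k+1))` by the `j_k`-th term of its own witness sequence, with
`N_k = σ_k (j_k)` strictly increasing; the diagonal family uses, at particle number `N_k`, the
ground state of the `k`-th family (every witness family has a ground state for every `N`, so no
padding is needed). [folklore] -/
theorem IsLocalLimitOfGroundStates.of_eventually_ballMatch
    {Xs : ℕ → Set (EuclideanSpace ℝ (Fin d))} (hXs : ∀ k, IsLocalLimitOfGroundStates V d (Xs k))
    (hlim : ∀ R ε : ℝ, 0 < ε → ∀ᶠ k : ℕ in Filter.atTop, BallMatch ε R 0 (Xs k) X) :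
    IsLocalLimitOfGroundStates V d X := by
  classical
  choose x σ τ hx hσ hmatch using hXs
  -- thresholds `J k` for the matching of `X_k` at scale `(k, 1/(k+1))`
  have hth := fun k : ℕ =>
    Filter.eventually_atTop.1 (hmatch k (k : ℝ) (1 / ((k : ℝ) + 1)) (by positivity))
  choose J hJ using hth
  -- diagonal indices and particle numbers
  have hjjJ : ∀ k, J k ≤ diagIdx J σ k := fun k => by
    cases k with
    | zero => exact le_rfl
    | succ k => exact le_max_left _ _
  have hNk : StrictMono fun k => σ k (diagIdx J σ k) := strictMono_nat_of_lt_succ fun k =>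
    calc σ k (diagIdx J σ k) < σ k (diagIdx J σ k) + 1 := Nat.lt_succ_self _
      _ ≤ diagIdx J σ (k + 1) := le_max_right _ _
      _ ≤ σ (k + 1) (diagIdx J σ (k + 1)) := (hσ (k + 1)).le_apply
  have hinv : ∀ k, Function.invFun (fun k => σ k (diagIdx J σ k)) (σ k (diagIdx J σ k)) = k :=
    Function.leftInverse_invFun hNk.injective
  refine ⟨fun N => x (Function.invFun (fun k => σ k (diagIdx J σ k)) N) N,
    fun k => σ k (diagIdx J σ k), fun k => τ k (diagIdx J σ k), fun N => hx _ N, hNk,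
    fun R ε hε => ?_⟩
  -- work at tolerance `ε₁ ≤ min (ε/2) (1/2)`
  set ε₁ : ℝ := min (ε / 2) (1 / 2) with hε₁
  have hε₁0 : 0 < ε₁ := lt_min (half_pos hε) one_half_pos
  have hε₁ε : 2 * ε₁ ≤ ε := by have := min_le_left (ε / 2) (1 / 2); linarith
  have hε₁1 : ε₁ ≤ 1 / 2 := min_le_right _ _
  filter_upwards [hlim (R + 1) ε₁ hε₁0,
    Filter.eventually_ge_atTop ⌈max (R + 1) (1 / ε₁)⌉₊] with k hk1 hk2
  have hk2' : max (R + 1) (1 / ε₁) ≤ (k : ℝ) := (Nat.le_ceil _).trans (by exact_mod_cast hk2)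
  have hkR : R + 1 ≤ k := (le_max_left _ _).trans hk2'
  have hkε : 1 / ((k : ℝ) + 1) ≤ ε₁ := by
    have h1 : 1 / ε₁ ≤ k := (le_max_right _ _).trans hk2'
    rw [div_le_iff₀ hε₁0] at h1
    rw [div_le_iff₀ (by positivity)]
    nlinarith
  obtain ⟨hAk, hBk⟩ := hJ k (diagIdx J σ k) (hjjJ k)
  obtain ⟨hM1, hM2⟩ := hk1
  simp only [hinv]
  refine ⟨fun p hp hpR => ?_, fun i hi => ?_⟩
  · obtain ⟨a, ha, hap⟩ := hM1 p hp (by rw [dist_zero_right]; linarith)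
    have haR : ‖a‖ ≤ k := by linarith [norm_le_norm_add_dist a p]
    obtain ⟨i, hi⟩ := hAk a ha haR
    refine ⟨i, ?_⟩
    calc dist (x k (σ k (diagIdx J σ k)) i + τ k (diagIdx J σ k)) p
        ≤ dist (x k (σ k (diagIdx J σ k)) i + τ k (diagIdx J σ k)) a + dist a p :=
          dist_triangle _ _ _
      _ ≤ ε₁ + ε₁ := add_le_add (hi.trans hkε) hap
      _ ≤ ε := by linarith
  · obtain ⟨p', hp', hip'⟩ := hBk i (hi.trans (by linarith))
    have hp'R : dist p' 0 ≤ R + 1 := by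
      rw [dist_zero_right]
      have := norm_le_norm_add_dist p' (x k (σ k (diagIdx J σ k)) i + τ k (diagIdx J σ k))
      rw [dist_comm] at this
      linarith [hip'.trans hkε]
    obtain ⟨s, hs, hps⟩ := hM2 p' hp' hp'R
    refine ⟨s, hs, ?_⟩
    calc dist (x k (σ k (diagIdx J σ k)) i + τ k (diagIdx J σ k)) s
        ≤ dist (x k (σ k (diagIdx J σ k)) i + τ k (diagIdx J σ k)) p' + dist p' s :=
          dist_triangle _ _ _
      _ ≤ ε₁ + ε₁ := add_le_add (hip'.trans hkε) hps
      _ ≤ ε := by linarith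

/-- In particular `𝔏` is closed in the local matching topology: if `X' ∈ 𝔏` and `X'`, `X` are
two-way `ε`-matched on every ball for every `ε > 0` (e.g. `X` and `X'` have the same closure),
then `X ∈ 𝔏`. [folklore] -/
theorem IsLocalLimitOfGroundStates.of_forall_ballMatch {X' : Set (EuclideanSpace ℝ (Fin d))}
    (hX' : IsLocalLimitOfGroundStates V d X')
    (h : ∀ R ε : ℝ, 0 < ε → BallMatch ε R 0 X' X) : IsLocalLimitOfGroundStates V d X :=
  IsLocalLimitOfGroundStates.of_eventually_ballMatch (fun _ => hX')
    fun R ε hε => Filter.Eventually.of_forall fun _ => h R ε hε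

end Literature.MathematicalPhysics.StatisticalMechanics

end
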